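import Summits.ValiantsHypothesis.ValiantsHypothesis.Theorems.KPlusLogSqLawTropicalSymmetricOrbitThreeFourV2A

/-!
# Route «KPlusLogSqLaw» — the symmetric `(3,4)` tropical row in the ORBIT model — abstract exclusion lemmas, part 5:
# towards the orbit core V2: a pair carrier on `{0,2,3}` with two transpositions (`K4`), and `{0,0,3}` as a transposition (`K8`, `K9`)

HONEST FRAMING.  Helper file (seat val-sym-lift-p2 (g6), cell `pub-symmetroid`, 2026-08-27; `--supports` the `WeakLifting` item
stmt-ValiantsHypothesis-19561 as a helper, no closure claim).  A SMALL-FORMAT statement in the transpose-ORBIT carrier model, far inside the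
known regime of the cruxes; port blueprint `HOME/val-sym-lift-p2/g6/LEMMA-Z-liftp2g6.md` §6–§7 (typed case tree `exp/casetree_V2orb.txt`).
Nothing here is about `TropicalB` / `WeakLifting` in their windows, Conjecture B, DoorA34 = `PosRootLawAt 3 4 18` (OPEN, never asserted),
`MatrixDescartes` (stmt-ValiantsHypothesis-18050) or VP ≠ VNP; `TSymOrb34Le17` / `TSymOrb34Le16` stay targets (NOT asserted).

THIS FILE.  `K4` (`{0,2,3} = C`, `{1,1,2} = T`, `{1,2,2} = T`: both transpositions are forced onto the pair where the carrier reads `2` — twin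
of `K3`), `K8` (`{0,0,3} = T`, `{0,2,3} = D`, `{1,2,2} = C`), `K9` (`{0,0,3} = T`, `{0,2,3} = D`, `{1,1,2} = C`, `{1,2,2} = T`).
[cell statement R1732; folklore-level exchange arguments, no citation exists]
-/

set_option linter.dupNamespace false
set_option autoImplicit false

namespace Summit.ValiantsHypothesis.ValiantsHypothesis.Theorems.KPlusLogSqLaw

open Summit.ValiantsHypothesis.ValiantsHypothesis.Theorems.MatrixDescartes.Negative
open Summit.ValiantsHypothesis.ValiantsHypothesis.Theorems.LacunarySymmetroidMatrixDescartes
open Summit.ValiantsHypothesis.ValiantsHypothesis.Theorems.LacunarySymmetroidMatrixDescartes.TropicalCensus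
open Finset

namespace SymmetricOrbitThreeFour

open SymmetricThreeFour SymmetricThreeFourSeventeen SymmetricThreeFourSixteen SymmetricThreeFourFifteen

/-- **`K4`**: `{0,2,3}` carried by a pair carrier, `{1,1,2}` and `{1,2,2}` by transposition terms — impossible. [hM, hR2, hR2'; twin of K3] -/
theorem K4 {n : ℕ} (r : Fin (n + 1) → Equiv.Perm (Fin 3) × (Fin 3 → Fin 4)) (g : Fin 4 → ℕ) (hmono : Monotone g)
    (hM : ∀ a b : Fin (n + 1), a < b → ∀ l₁ l₂ : Fin 3,
      ((r a).1 l₁ = (r b).1 l₂ ∧ l₁ = l₂) ∨ ((r a).1 l₁ = l₂ ∧ (r b).1 l₂ = l₁) → (r a).2 l₁ ≤ (r b).2 l₂)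
    (hR2 : ∀ a b : Fin (n + 1), a < b → ∀ i j k : Fin 3, i ≠ j → k ≠ i → k ≠ j → (r a).1 = Equiv.swap i j →
      (r a).2 i = (r a).2 j → (r b).1 i = j → (r b).1 j = k → (r b).1 k = i →
      g ((r a).2 k) + g ((r a).2 i) < g ((r b).2 j) + g ((r b).2 k))
    (hR2' : ∀ a b : Fin (n + 1), a < b → ∀ i j k : Fin 3, i ≠ j → k ≠ i → k ≠ j → (r a).1 i = j → (r a).1 j = k → (r a).1 k = i →
      (r b).1 = Equiv.swap i j → (r b).2 i = (r b).2 j → g ((r a).2 j) + g ((r a).2 k) < g ((r b).2 k) + g ((r b).2 i))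
    (a c e : Fin (n + 1)) (ha : ∀ x, (r a).1 x ≠ x)
    (haC : TropicalCensus.classSym (r a) = TropicalCensus.classSym ((1 : Equiv.Perm (Fin 3)), (![0, 2, 3] : Fin 3 → Fin 4)))
    (hcC : TropicalCensus.classSym (r c) = TropicalCensus.classSym ((1 : Equiv.Perm (Fin 3)), (![1, 1, 2] : Fin 3 → Fin 4)))
    (heC : TropicalCensus.classSym (r e) = TropicalCensus.classSym ((1 : Equiv.Perm (Fin 3)), (![1, 2, 2] : Fin 3 → Fin 4)))
    {i j : Fin 3} (hij : i < j) (hc1 : (r c).1 = Equiv.swap i j) (hcc : (r c).2 i = (r c).2 j)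
    {i' j' : Fin 3} (hij2 : i' < j') (he1 : (r e).1 = Equiv.swap i' j') (hee : (r e).2 i' = (r e).2 j') : False := by
  have f4_p' : ∀ x : Fin 4, x ≠ 1 → x ≠ 3 → x = 0 ∨ x = 2 := by decide
  have ca : ∀ l, (univ.filter fun t => (r a).2 t = l).card = (![1, 0, 1, 1] : Fin 4 → ℕ) l :=
    fun l => (card_filter_eq_of_classSym_eq haC l).trans (cnt023 l)
  have cc : ∀ l, (univ.filter fun t => (r c).2 t = l).card = (![0, 2, 1, 0] : Fin 4 → ℕ) l :=
    fun l => (card_filter_eq_of_classSym_eq hcC l).trans (cnt112 l)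
  have ce : ∀ l, (univ.filter fun t => (r e).2 t = l).card = (![0, 1, 2, 0] : Fin 4 → ℕ) l :=
    fun l => (card_filter_eq_of_classSym_eq heC l).trans (cnt122 l)
  have hac : a ≠ c := by intro h; have := ca 0; rw [h, cc 0] at this; exact absurd this (by decide)
  have hae : a ≠ e := by intro h; have := ca 0; rw [h, ce 0] at this; exact absurd this (by decide)
  have ua1 : ∀ t, (r a).2 t ≠ 1 := ne_of_card_zero _ 1 (by rw [ca 1]; rfl)
  have g01 : g 0 ≤ g 1 := hmono (by decide)
  have g12 : g 1 ≤ g 2 := hmono (by decide)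
  have g23 : g 2 ≤ g 3 := hmono (by decide)
  obtain ⟨k, hki, hkj⟩ := exists_third i j
  obtain ⟨k', hki', hkj'⟩ := exists_third i' j'
  have hij' : i ≠ j := ne_of_lt hij
  have hij2' : i' ≠ j' := ne_of_lt hij2
  have c_only := letters12 r c (by rw [cc 0]; rfl) (by rw [cc 3]; rfl)
  have e_only := letters12 r e (by rw [ce 0]; rfl) (by rw [ce 3]; rfl)
  obtain ⟨hci, hck⟩ := swap_letters r c hij' hki hkj hcc 2 1 (by rw [cc 2]; rfl) (by rw [cc 1]; rfl)
    (fun l => (c_only l).symm)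
  obtain ⟨hei, hek⟩ := swap_letters r e hij2' hki' hkj' hee 1 2 (by rw [ce 1]; rfl) (by rw [ce 2]; rfl) e_only
  have a_ne0 : ∀ {t t' : Fin 3}, (r a).2 t = 0 → t' ≠ t → (r a).2 t' ≠ 0 := fun h hne => ne_of_card_one _ 0 (by rw [ca 0]; rfl) h hne
  have a_ne2 : ∀ {t t' : Fin 3}, (r a).2 t = 2 → t' ≠ t → (r a).2 t' ≠ 2 := fun h hne => ne_of_card_one _ 2 (by rw [ca 2]; rfl) h hne
  have a_ne3 : ∀ {t t' : Fin 3}, (r a).2 t = 3 → t' ≠ t → (r a).2 t' ≠ 3 := fun h hne => ne_of_card_one _ 3 (by rw [ca 3]; rfl) h hne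
  -- if the column `l` of `a` carries `3`, the other two carry `0` and `2`; if it carries `0`, they carry `2` and `3`
  have sum02 : ∀ l m t : Fin 3, l ≠ m → t ≠ l → t ≠ m → (r a).2 l = 3 → g ((r a).2 m) + g ((r a).2 t) = g 0 + g 2 := by
    intro l m t hlm htl htm hl3
    have hm := f4_i _ (a_ne3 hl3 hlm.symm)
    have ht := f4_i _ (a_ne3 hl3 htl)
    rcases f4_p' ((r a).2 m) (ua1 m) (a_ne3 hl3 hlm.symm) with hm0 | hm2 <;>
      rcases f4_p' ((r a).2 t) (ua1 t) (a_ne3 hl3 htl) with ht0 | ht2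
    · exact absurd ht0 (a_ne0 hm0 htm)
    · rw [hm0, ht2]
    · rw [hm2, ht0, add_comm]
    · exact absurd ht2 (a_ne2 hm2 htm)
  have sum23 : ∀ l m t : Fin 3, l ≠ m → t ≠ l → t ≠ m → (r a).2 l = 0 → g ((r a).2 m) + g ((r a).2 t) = g 2 + g 3 := by
    intro l m t hlm htl htm hl0
    rcases f4_h _ (f4_b _ (a_ne0 hl0 hlm.symm)) (ua1 m) with hm2 | hm3 <;>
      rcases f4_h _ (f4_b _ (a_ne0 hl0 htl)) (ua1 t) with ht2 | ht3
    · exact absurd ht2 (a_ne2 hm2 htm)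
    · rw [hm2, ht3]
    · rw [hm3, ht2, add_comm]
    · exact absurd ht3 (a_ne3 hm3 htm)
  -- `c` sits on the pair where `a` reads `2`, and comes before `a`
  obtain ⟨l, m, hlm, hσl, hlt1, hlt2⟩ := TC_facts r g hM hR2 hR2' c a hij' hki hkj hc1 hcc ha
  have hlmk : l ≠ m ∧ k ≠ l ∧ k ≠ m := by
    rcases hlm with ⟨rfl, rfl⟩ | ⟨rfl, rfl⟩
    · exact ⟨hij', hki, hkj⟩
    · exact ⟨hij'.symm, hkj, hki⟩
  have hca : c < a := by
    rcases lt_or_gt_of_ne hac with hlt | hlt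
    · exfalso
      obtain ⟨hle, hC⟩ := hlt2 hlt
      rw [hci, hck] at *
      have hl0 : (r a).2 l = 0 := f4_f _ hle (ua1 l)
      have := sum23 l m k hlmk.1 hlmk.2.1 hlmk.2.2 hl0
      omega
    · exact hlt
  have hal2 : (r a).2 l = 2 := by
    obtain ⟨hle, hC⟩ := hlt1 hca
    rw [hci, hck] at *
    rcases f4_h _ hle (ua1 l) with h2 | h3
    · exact h2
    · exfalso; have := sum02 l m k hlmk.1 hlmk.2.1 hlmk.2.2 h3; omega
  have gca : g 1 + g 2 < g 0 + g 3 := by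
    obtain ⟨_, hC⟩ := hlt1 hca
    rw [hci, hck] at hC
    -- the other two letters of `a` are `0` and `3`
    have hm := a_ne2 hal2 hlmk.1.symm
    have hk := a_ne2 hal2 hlmk.2.1
    rcases f4_c _ (ua1 m) hm with hm0 | hm3 <;> rcases f4_c _ (ua1 k) hk with hk0 | hk3
    · exact absurd hk0 (a_ne0 hm0 hlmk.2.2)
    · rw [hm0, hk3] at hC; omega
    · rw [hm3, hk0] at hC; omega
    · exact absurd hk3 (a_ne3 hm3 hlmk.2.2)
  -- `e` sits on the pair where `a` reads `2`, too
  obtain ⟨l', m', hlm', hσl', hlt1', hlt2'⟩ := TC_facts r g hM hR2 hR2' e a hij2' hki' hkj' he1 hee ha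
  have hlmk' : l' ≠ m' ∧ k' ≠ l' ∧ k' ≠ m' := by
    rcases hlm' with ⟨rfl, rfl⟩ | ⟨rfl, rfl⟩
    · exact ⟨hij2', hki', hkj'⟩
    · exact ⟨hij2'.symm, hkj', hki'⟩
  have hal2' : (r a).2 l' = 2 := by
    rcases lt_or_gt_of_ne hae with hlt | hlt
    · obtain ⟨hle, hC⟩ := hlt2' hlt
      rw [hei, hek] at *
      rcases f4_p' _ (ua1 l') (fun h3 => by rw [h3] at hle; exact absurd hle (by decide)) with h0 | h2
      · exfalso; have := sum23 l' m' k' hlmk'.1 hlmk'.2.1 hlmk'.2.2 h0; omega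
      · exfalso
        -- `a` before `e` with `a_l' = 2`: the other letters are `0, 3` and `g 0 + g 3 < g 1 + g 2`
        have hm := a_ne2 h2 hlmk'.1.symm
        have hk := a_ne2 h2 hlmk'.2.1
        rcases f4_c _ (ua1 m') hm with hm0 | hm3 <;> rcases f4_c _ (ua1 k') hk with hk0 | hk3
        · exact absurd hk0 (a_ne0 hm0 hlmk'.2.2)
        · rw [hm0, hk3] at hC; omega
        · rw [hm3, hk0] at hC; omega
        · exact absurd hk3 (a_ne3 hm3 hlmk'.2.2)
    · obtain ⟨hle, hC⟩ := hlt1' hlt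
      rw [hei, hek] at *
      rcases f4_h _ (le_trans (by decide) hle) (ua1 l') with h2 | h3
      · exact h2
      · exfalso; have := sum02 l' m' k' hlmk'.1 hlmk'.2.1 hlmk'.2.2 h3; omega
  -- hence the same pair, the same transposition, the same fixed column
  have hll : l' = l := by
    by_contra hne; exact a_ne2 hal2 hne hal2'
  have hmm : m' = m := by rw [← hσl', hll, hσl]
  have hperm : (r e).1 = (r c).1 := by
    rw [he1, hc1]
    rcases hlm with ⟨h1, h2⟩ | ⟨h1, h2⟩ <;> rcases hlm' with ⟨h1', h2'⟩ | ⟨h1', h2'⟩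
    · rw [← h1', hll, h1, ← h2', hmm, h2]
    · rw [← h2', hmm, h2, ← h1', hll, h1, Equiv.swap_comm]
    · rw [← h1', hll, h1, ← h2', hmm, h2, Equiv.swap_comm]
    · rw [← h2', hmm, h2, ← h1', hll, h1]
  have hkk : k' = k := by
    by_contra hne
    have hk'l : k' ≠ l := hll ▸ hlmk'.2.1
    have hk'm : k' ≠ m := hmm ▸ hlmk'.2.2
    rcases hlm with ⟨h1, h2⟩ | ⟨h1, h2⟩
    · rcases eq_or_eq_of_ne_third i j k k' hij' hki.symm hkj.symm hne with h | h
      · exact hk'l (h.trans h1.symm)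
      · exact hk'm (h.trans h2.symm)
    · rcases eq_or_eq_of_ne_third i j k k' hij' hki.symm hkj.symm hne with h | h
      · exact hk'm (h.trans h2.symm)
      · exact hk'l (h.trans h1.symm)
  have hce' : c ≠ e := by intro h; have := cc 1; rw [h, ce 1] at this; exact absurd this (by decide)
  have hi_in : i = i' ∨ i = j' := by
    rcases hlm with ⟨h1, h2⟩ | ⟨h1, h2⟩
    · rcases hlm' with ⟨h1', _⟩ | ⟨h1', _⟩
      · exact Or.inl (h1.symm.trans (hll.symm.trans h1'))
      · exact Or.inr (h1.symm.trans (hll.symm.trans h1'))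
    · rcases hlm' with ⟨_, h2'⟩ | ⟨_, h2'⟩
      · exact Or.inr (h2.symm.trans (hmm.symm.trans h2'))
      · exact Or.inl (h2.symm.trans (hmm.symm.trans h2'))
  have hei2 : (r e).2 i = 2 := by
    rcases hi_in with h | h
    · rw [h]; exact hei
    · rw [h, ← hee]; exact hei
  rcases lt_or_gt_of_ne hce' with hlt | hlt
  · have hle := hM c e hlt k k (Or.inl ⟨by rw [hperm], rfl⟩)
    rw [hck, ← hkk, hek] at hle
    exact absurd hle (by decide)
  · have hle := hM e c hlt i i (Or.inl ⟨by rw [hperm], rfl⟩)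
    rw [hei2, hci] at hle
    exact absurd hle (by decide)

/-- **`TD_frame`**: `{0,0,3} = T(3|0)` (index `t`, transposition `swap i j`) against `{0,2,3} = D(w)` (index `b`): the transposition comes
first, its fixed column `k` is the `3`-column of `w`, its pair carries `0`, and `{w i, w j} = {0, 2}`. [hM, hR1] -/
theorem TD_frame {n : ℕ} (r : Fin (n + 1) → Equiv.Perm (Fin 3) × (Fin 3 → Fin 4)) (g : Fin 4 → ℕ) (hmono : Monotone g)
    (hM : ∀ a b : Fin (n + 1), a < b → ∀ l₁ l₂ : Fin 3,
      ((r a).1 l₁ = (r b).1 l₂ ∧ l₁ = l₂) ∨ ((r a).1 l₁ = l₂ ∧ (r b).1 l₂ = l₁) → (r a).2 l₁ ≤ (r b).2 l₂)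
    (hR1 : ∀ a b : Fin (n + 1), a < b → (r a).1 = 1 → ∀ i j : Fin 3, i ≠ j → (r b).1 = Equiv.swap i j → (r b).2 i = (r b).2 j →
      g ((r a).2 i) + g ((r a).2 j) < 2 * g ((r b).2 i))
    (t b : Fin (n + 1)) (hb1 : (r b).1 = 1)
    (htC : TropicalCensus.classSym (r t) = TropicalCensus.classSym ((1 : Equiv.Perm (Fin 3)), (![0, 0, 3] : Fin 3 → Fin 4)))
    (hbC : TropicalCensus.classSym (r b) = TropicalCensus.classSym ((1 : Equiv.Perm (Fin 3)), (![0, 2, 3] : Fin 3 → Fin 4)))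
    {i j : Fin 3} (hij : i < j) (ht1 : (r t).1 = Equiv.swap i j) (htt : (r t).2 i = (r t).2 j) :
    ∃ k : Fin 3, k ≠ i ∧ k ≠ j ∧ t < b ∧ (r t).2 i = 0 ∧ (r t).2 k = 3 ∧ (r b).2 k = 3 ∧
      (((r b).2 i = 0 ∧ (r b).2 j = 2) ∨ ((r b).2 i = 2 ∧ (r b).2 j = 0)) := by
  have ct : ∀ l, (univ.filter fun x => (r t).2 x = l).card = (![2, 0, 0, 1] : Fin 4 → ℕ) l :=
    fun l => (card_filter_eq_of_classSym_eq htC l).trans (cnt003 l)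
  have cb : ∀ l, (univ.filter fun x => (r b).2 x = l).card = (![1, 0, 1, 1] : Fin 4 → ℕ) l :=
    fun l => (card_filter_eq_of_classSym_eq hbC l).trans (cnt023 l)
  have hij' : i ≠ j := ne_of_lt hij
  obtain ⟨k, hki, hkj⟩ := exists_third i j
  have t_only : ∀ l, (r t).2 l = 3 ∨ (r t).2 l = 0 := fun l =>
    (f4_c _ (ne_of_card_zero _ 1 (by rw [ct 1]; rfl) l) (ne_of_card_zero _ 2 (by rw [ct 2]; rfl) l)).symm
  obtain ⟨hti, htk⟩ := swap_letters r t hij' hki hkj htt 3 0 (by rw [ct 3]; rfl) (by rw [ct 0]; rfl) t_only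
  have htb : t ≠ b := by intro h; have := ct 0; rw [h, cb 0] at this; exact absurd this (by decide)
  have wb1 : ∀ l, (r b).2 l ≠ 1 := ne_of_card_zero _ 1 (by rw [cb 1]; rfl)
  have htk' : (r t).1 k = k := by rw [ht1, Equiv.swap_apply_of_ne_of_ne hki hkj]
  have g0le : ∀ y : Fin 4, g 0 ≤ g y := fun y => hmono (Fin.zero_le _)
  have hlt : t < b := by
    rcases lt_or_gt_of_ne htb with h | h
    · exact h
    · exfalso
      have hC := hR1 b t h hb1 i j hij' ht1 htt
      rw [hti] at hC
      have := g0le ((r b).2 i); have := g0le ((r b).2 j); omega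
  have hw3 : (r b).2 k = 3 := by
    have hle := hM t b hlt k k (Or.inl ⟨by rw [hb1, htk', Equiv.Perm.one_apply], rfl⟩)
    rw [htk] at hle
    exact le_antisymm (Fin.le_last _) hle
  have hwi3 : (r b).2 i ≠ 3 := ne_of_card_one _ 3 (by rw [cb 3]; rfl) hw3 hki.symm
  have hwj3 : (r b).2 j ≠ 3 := ne_of_card_one _ 3 (by rw [cb 3]; rfl) hw3 hkj.symm
  refine ⟨k, hki, hkj, hlt, hti, htk, hw3, ?_⟩
  by_cases hi0 : (r b).2 i = 0
  · exact Or.inl ⟨hi0, f4_j _ (ne_of_card_one _ 0 (by rw [cb 0]; rfl) hi0 hij'.symm) (wb1 j) hwj3⟩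
  · have hi2 : (r b).2 i = 2 := f4_j _ hi0 (wb1 i) hwi3
    refine Or.inr ⟨hi2, ?_⟩
    rcases f4_c _ (wb1 j) (ne_of_card_one _ 2 (by rw [cb 2]; rfl) hi2 hij'.symm) with h | h
    · exact h
    · exact absurd h hwj3

/-- **`K9`**: `{0,0,3} = T`, `{0,2,3} = D`, `{1,1,2} = C`, `{1,2,2} = T` is impossible. [TD_frame, TC_facts, orbY2] -/
theorem K9 {n : ℕ} (r : Fin (n + 1) → Equiv.Perm (Fin 3) × (Fin 3 → Fin 4)) (g : Fin 4 → ℕ) (hmono : Monotone g)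
    (hM : ∀ a b : Fin (n + 1), a < b → ∀ l₁ l₂ : Fin 3,
      ((r a).1 l₁ = (r b).1 l₂ ∧ l₁ = l₂) ∨ ((r a).1 l₁ = l₂ ∧ (r b).1 l₂ = l₁) → (r a).2 l₁ ≤ (r b).2 l₂)
    (hR1 : ∀ a b : Fin (n + 1), a < b → (r a).1 = 1 → ∀ i j : Fin 3, i ≠ j → (r b).1 = Equiv.swap i j → (r b).2 i = (r b).2 j →
      g ((r a).2 i) + g ((r a).2 j) < 2 * g ((r b).2 i))
    (hR1' : ∀ a b : Fin (n + 1), a < b → (r b).1 = 1 → ∀ i j : Fin 3, i ≠ j → (r a).1 = Equiv.swap i j → (r a).2 i = (r a).2 j →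
      2 * g ((r a).2 i) < g ((r b).2 i) + g ((r b).2 j))
    (hR2 : ∀ a b : Fin (n + 1), a < b → ∀ i j k : Fin 3, i ≠ j → k ≠ i → k ≠ j → (r a).1 = Equiv.swap i j →
      (r a).2 i = (r a).2 j → (r b).1 i = j → (r b).1 j = k → (r b).1 k = i →
      g ((r a).2 k) + g ((r a).2 i) < g ((r b).2 j) + g ((r b).2 k))
    (hR2' : ∀ a b : Fin (n + 1), a < b → ∀ i j k : Fin 3, i ≠ j → k ≠ i → k ≠ j → (r a).1 i = j → (r a).1 j = k → (r a).1 k = i →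
      (r b).1 = Equiv.swap i j → (r b).2 i = (r b).2 j → g ((r a).2 j) + g ((r a).2 k) < g ((r b).2 k) + g ((r b).2 i))
    (t b y e : Fin (n + 1)) (hb1 : (r b).1 = 1) (hy : ∀ x, (r y).1 x ≠ x)
    (htC : TropicalCensus.classSym (r t) = TropicalCensus.classSym ((1 : Equiv.Perm (Fin 3)), (![0, 0, 3] : Fin 3 → Fin 4)))
    (hbC : TropicalCensus.classSym (r b) = TropicalCensus.classSym ((1 : Equiv.Perm (Fin 3)), (![0, 2, 3] : Fin 3 → Fin 4)))
    (hyC : TropicalCensus.classSym (r y) = TropicalCensus.classSym ((1 : Equiv.Perm (Fin 3)), (![1, 1, 2] : Fin 3 → Fin 4)))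
    (heC : TropicalCensus.classSym (r e) = TropicalCensus.classSym ((1 : Equiv.Perm (Fin 3)), (![1, 2, 2] : Fin 3 → Fin 4)))
    {i j : Fin 3} (hij : i < j) (ht1 : (r t).1 = Equiv.swap i j) (htt : (r t).2 i = (r t).2 j)
    (heshape : (r e).1 = 1 ∨ ∃ i' j' : Fin 3, i' < j' ∧ (r e).1 = Equiv.swap i' j' ∧ (r e).2 i' = (r e).2 j') : False := by
  obtain ⟨k, hki, hkj, -, hti, htk, -, -⟩ := TD_frame r g hmono hM hR1 t b hb1 htC hbC hij ht1 htt
  have cy : ∀ l, (univ.filter fun x => (r y).2 x = l).card = (![0, 2, 1, 0] : Fin 4 → ℕ) l :=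
    fun l => (card_filter_eq_of_classSym_eq hyC l).trans (cnt112 l)
  have y12 := letters12 r y (by rw [cy 0]; rfl) (by rw [cy 3]; rfl)
  have y_ne2 : ∀ {x x' : Fin 3}, (r y).2 x = 2 → x' ≠ x → (r y).2 x' = 1 := fun {x x'} h hne => by
    rcases y12 x' with h' | h'
    · exact h'
    · exact absurd h' (ne_of_card_one _ 2 (by rw [cy 2]; rfl) h hne)
  have y2 := orbY2 r g hmono hM hR1 hR1' b e hb1 hbC heC heshape
  have g12 : g 1 ≤ g 2 := hmono (by decide)
  have hij' : i ≠ j := ne_of_lt hij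
  have hty : t ≠ y := by
    intro h; rw [h] at ht1; exact swap_not_fpf i j hij (ht1 ▸ hy)
  obtain ⟨l, m, hlm, hσl, hlt1, hlt2⟩ := TC_facts r g hM hR2 hR2' t y hij' hki hkj ht1 htt hy
  have hmk : m ≠ k := by
    rcases hlm with ⟨_, rfl⟩ | ⟨_, rfl⟩
    · exact hkj.symm
    · exact hki.symm
  rcases lt_or_gt_of_ne hty with h | h
  · obtain ⟨-, hC⟩ := hlt1 h
    rw [htk, hti] at hC
    rcases y12 m with hm | hm <;> rcases y12 k with hk | hk
    · rw [hm, hk] at hC; omega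
    · rw [hm, hk] at hC; omega
    · rw [hm, hk] at hC; omega
    · exact absurd hk (by rw [y_ne2 hm hmk.symm]; decide)
  · obtain ⟨hle, -⟩ := hlt2 h
    rw [hti] at hle
    rcases y12 l with h' | h' <;> rw [h'] at hle <;> exact absurd hle (by decide)

/-- **`K8`**: `{0,0,3} = T`, `{0,2,3} = D`, `{1,2,2} = C` is impossible. [TD_frame, TC_facts, R3w / R3′w] -/
theorem K8 {n : ℕ} (r : Fin (n + 1) → Equiv.Perm (Fin 3) × (Fin 3 → Fin 4)) (g : Fin 4 → ℕ) (hmono : Monotone g)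
    (hM : ∀ a b : Fin (n + 1), a < b → ∀ l₁ l₂ : Fin 3,
      ((r a).1 l₁ = (r b).1 l₂ ∧ l₁ = l₂) ∨ ((r a).1 l₁ = l₂ ∧ (r b).1 l₂ = l₁) → (r a).2 l₁ ≤ (r b).2 l₂)
    (hR1 : ∀ a b : Fin (n + 1), a < b → (r a).1 = 1 → ∀ i j : Fin 3, i ≠ j → (r b).1 = Equiv.swap i j → (r b).2 i = (r b).2 j →
      g ((r a).2 i) + g ((r a).2 j) < 2 * g ((r b).2 i))
    (hR2 : ∀ a b : Fin (n + 1), a < b → ∀ i j k : Fin 3, i ≠ j → k ≠ i → k ≠ j → (r a).1 = Equiv.swap i j →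
      (r a).2 i = (r a).2 j → (r b).1 i = j → (r b).1 j = k → (r b).1 k = i →
      g ((r a).2 k) + g ((r a).2 i) < g ((r b).2 j) + g ((r b).2 k))
    (hR2' : ∀ a b : Fin (n + 1), a < b → ∀ i j k : Fin 3, i ≠ j → k ≠ i → k ≠ j → (r a).1 i = j → (r a).1 j = k → (r a).1 k = i →
      (r b).1 = Equiv.swap i j → (r b).2 i = (r b).2 j → g ((r a).2 j) + g ((r a).2 k) < g ((r b).2 k) + g ((r b).2 i))
    (hR3 : ∀ a b : Fin (n + 1), a < b → (r a).1 = 1 → ∀ i j k : Fin 3, i ≠ j → k ≠ i → k ≠ j →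
      (r b).1 i = j → (r b).1 j = k → (r b).1 k = i → g ((r a).2 i) + g ((r a).2 j) < 2 * g ((r b).2 i))
    (hR3' : ∀ a b : Fin (n + 1), a < b → (r b).1 = 1 → ∀ i j k : Fin 3, i ≠ j → k ≠ i → k ≠ j →
      (r a).1 i = j → (r a).1 j = k → (r a).1 k = i → 2 * g ((r a).2 i) < g ((r b).2 i) + g ((r b).2 j))
    (t b y : Fin (n + 1)) (hb1 : (r b).1 = 1) (hy : ∀ x, (r y).1 x ≠ x)
    (htC : TropicalCensus.classSym (r t) = TropicalCensus.classSym ((1 : Equiv.Perm (Fin 3)), (![0, 0, 3] : Fin 3 → Fin 4)))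
    (hbC : TropicalCensus.classSym (r b) = TropicalCensus.classSym ((1 : Equiv.Perm (Fin 3)), (![0, 2, 3] : Fin 3 → Fin 4)))
    (hyC : TropicalCensus.classSym (r y) = TropicalCensus.classSym ((1 : Equiv.Perm (Fin 3)), (![1, 2, 2] : Fin 3 → Fin 4)))
    {i j : Fin 3} (hij : i < j) (ht1 : (r t).1 = Equiv.swap i j) (htt : (r t).2 i = (r t).2 j) : False := by
  obtain ⟨k, hki, hkj, -, hti, htk, hw3, hwij⟩ := TD_frame r g hmono hM hR1 t b hb1 htC hbC hij ht1 htt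
  have cy : ∀ l, (univ.filter fun x => (r y).2 x = l).card = (![0, 1, 2, 0] : Fin 4 → ℕ) l :=
    fun l => (card_filter_eq_of_classSym_eq hyC l).trans (cnt122 l)
  have y12 := letters12 r y (by rw [cy 0]; rfl) (by rw [cy 3]; rfl)
  have gy2 : ∀ x, g ((r y).2 x) ≤ g 2 := fun x => by rcases y12 x with h | h <;> rw [h]; exact hmono (by decide)
  have y_ne1 : ∀ {x x' : Fin 3}, (r y).2 x = 1 → x' ≠ x → (r y).2 x' = 2 := fun {x x'} h hne => by
    rcases y12 x' with h' | h'
    · exact absurd h' (ne_of_card_one _ 1 (by rw [cy 1]; rfl) h hne)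
    · exact h'
  have g02 : g 0 ≤ g 2 := hmono (by decide)
  have g23 : g 2 ≤ g 3 := hmono (by decide)
  have hij' : i ≠ j := ne_of_lt hij
  have hty : t ≠ y := by
    intro h; rw [h] at ht1; exact swap_not_fpf i j hij (ht1 ▸ hy)
  have hby : b ≠ y := by intro h; rw [h] at hb1; exact fpf_ne_one hy hb1
  obtain ⟨l, m, hlm, hσl, hlt1, hlt2⟩ := TC_facts r g hM hR2 hR2' t y hij' hki hkj ht1 htt hy
  have hlmk : l ≠ m ∧ k ≠ l ∧ k ≠ m := by
    rcases hlm with ⟨rfl, rfl⟩ | ⟨rfl, rfl⟩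
    · exact ⟨hij', hki, hkj⟩
    · exact ⟨hij'.symm, hkj, hki⟩
  obtain ⟨hmk, hkl⟩ := fpf_next (r y).1 hy l m k hlmk.1 hlmk.2.1 hlmk.2.2 hσl
  -- `t` before `y`: `g 0 + g 3 < g(y m) + g(y k)`
  have hC : g 3 + g 0 < g ((r y).2 m) + g ((r y).2 k) := by
    rcases lt_or_gt_of_ne hty with h | h
    · obtain ⟨-, hC⟩ := hlt1 h
      rw [htk, hti] at hC; exact hC
    · exfalso
      obtain ⟨hle, -⟩ := hlt2 h
      rw [hti] at hle
      rcases y12 l with h' | h' <;> rw [h'] at hle <;> exact absurd hle (by decide)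
  -- `w` on the pair `{l, m}` reads `0, 2`; which of `l, m` carries the `0`
  have hw0 : ((r b).2 l = 0 ∧ (r b).2 m = 2) ∨ ((r b).2 l = 2 ∧ (r b).2 m = 0) := by
    rcases hlm with ⟨h1, h2⟩ | ⟨h1, h2⟩ <;> rw [h1, h2]
    · exact hwij
    · rcases hwij with ⟨a0, a2⟩ | ⟨a2, a0⟩
      · exact Or.inr ⟨a2, a0⟩
      · exact Or.inl ⟨a0, a2⟩
  -- `y` before `D(w)`
  have hyb : y < b := by
    rcases lt_or_gt_of_ne hby with h | h
    · exfalso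
      -- D(w) before C: use the pair of `w` containing `3` and `2`
      rcases hw0 with ⟨_, hm2⟩ | ⟨hl2, _⟩
      · have h2 := hR3 b y h hb1 m k l (fun hh => hlmk.2.2 hh.symm) hlmk.1 (fun hh => hlmk.2.1 hh.symm) hmk hkl hσl
        rw [hm2, hw3] at h2; have := gy2 m; omega
      · have h2 := hR3 b y h hb1 k l m hlmk.2.1 (fun hh => hlmk.2.2 hh.symm) (fun hh => hlmk.1 hh.symm) hkl hσl hmk
        rw [hw3, hl2] at h2; have := gy2 k; omega
    · exact h
  have c1 := hR3' y b hyb hb1 l m k hlmk.1 hlmk.2.1 hlmk.2.2 hσl hmk hkl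
  have hyl : (r y).2 l = 1 := by
    rcases y12 l with h | h
    · exact h
    · exfalso; rw [h] at c1
      rcases hw0 with ⟨hl0, hm2⟩ | ⟨hl2, hm0⟩
      · rw [hl0, hm2] at c1; omega
      · rw [hl2, hm0] at c1; omega
  rw [y_ne1 hyl hlmk.1.symm, y_ne1 hyl hlmk.2.1] at hC
  rcases hw0 with ⟨hl0, _⟩ | ⟨_, hm0⟩
  · have c3 := hR3' y b hyb hb1 k l m hlmk.2.1 (fun hh => hlmk.2.2 hh.symm) (fun hh => hlmk.1 hh.symm) hkl hσl hmk
    rw [y_ne1 hyl hlmk.2.1, hw3, hl0] at c3; omega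
  · have c2 := hR3' y b hyb hb1 m k l (fun hh => hlmk.2.2 hh.symm) hlmk.1 (fun hh => hlmk.2.1 hh.symm) hmk hkl hσl
    rw [y_ne1 hyl hlmk.1.symm, hm0, hw3] at c2; omega

end SymmetricOrbitThreeFour

end Summit.ValiantsHypothesis.ValiantsHypothesis.Theorems.KPlusLogSqLaw
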